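import Summits.Ventures.CertifiedManyBodySolver.Observables.PairODLROCeilingTL
import Literature.MathematicalPhysics.QuantumLattice.HubbardNNNHoppingPairCorrelatorD4Certificate
import Literature.MathematicalPhysics.QuantumLattice.HubbardNNNHoppingTorusLimitCorrelator
import Literature.MathematicalPhysics.QuantumLattice.PairFieldBoxAverageBound
import HarnessLib

/-!
# Torus dictionary for the box pair word and the KINEMATIC domination
# `|B|² · L⁻⁴ Re⟨ψ, Δ_d† Δ_d ψ⟩ ≤ Re ω̄_ψ(Γ(ι) pairBoxWord B)` for every torus state (part 1 of 2;
# part 2 = `Observables/PairLROTorusCeiling.lean`: certificate ⇒ `liminf` of `HubbardSuperconductivity`'s sequence)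

HONEST FRAMING: first certified bounds on pairing observables; not a superconductivity verdict; every
number certified (two lineages + referee) or labelled float. Crew hubbard-obs (D-0042), seat hubbard-obs-p1
(`prover-hubbard-obs-p1-g0-0`). Theorem-only; zero compute; no named fact; no `sorry`.

`Observables/PairODLROCeilingTL.lean` / `PairBoxWordD4.lean` read a box-pair-word certificate in the
torus-LIMIT states (ODLRO density = Bragg weight of the translation-invariant limit state). This file reads
the SAME certificate (finite-range identity in `𝔄_{Λ'}`, translation + point-group labels `γₗ ∈ S`, λ-form
`λ•O + Γ E_Φ − E_cert•1 − Σμ(n − ν•1) = SOS + …`, `λ < 0`) on the FINITE tori, where the summit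
`HubbardSuperconductivity` lives:

* §1 torus dictionary: `Γ(ι_{Λ_B,L})(pairBoxWord B) = Σ_{x,y∈B} (Δ^L_x̄)† Δ^L_ȳ`
  (`fermionEmbed_toTorusEmb_pairBoxWord`), and the space-group average of a pair two-point word at
  `(a, b)` is `Σ_{γ∈S} Σ_z Δ_z† Δ_{z+γ(b−a)}` (`sum_spaceGroupUnitary_conj_localPair_corr'`, the `(a,b)`
  version of the tree's `(0, r)` lemma), so that
  `Re ω̄_ψ(Γ(ι) pairBoxWord B) = (L²|S|)⁻¹ Σ_{γ∈S} Σ_{x,y∈B} Re⟨ψ, Σ_z Δ_z† Δ_{z+γ(ȳ−x̄)} ψ⟩`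
  (`re_orbitState_pairBoxWord_eq`);
* §2 KINEMATIC (every vector `ψ`, every `S ∋ 1`, `d`-wave): by the torus box-average (Fejér) bound
  `pairField_card_sq_mul_re_expect_le` applied to each rotated box `γB̄`,
  **`|B|² · L⁻⁴ · Re⟨ψ, Δ_d† Δ_d ψ⟩ ≤ Re ω̄_ψ(Γ(ι_{Λ_B,L}) pairBoxWord B)`**
  (`sq_card_mul_pairFieldDensity_le_re_orbitState_pairBoxWord`) — the orbit-averaged box functional
  dominates the pair-field (LRO) density of the SAME torus state;
* §3–§4 (certificate ⇒ finite-torus ceiling with slack ⇒ `liminf` of the summit's sequence) are in part 2.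
HONEST: a certified CEILING on the summit's LRO sequence at one `(U, n, t′)`; it neither proves nor refutes
the summit (which asserts `liminf > 0` for SOME `U, δ`); "non-trivial" only relative to the kinematic
value `4 · p_d(0,0)`-type boxes; no number lives in this file.
-/

noncomputable section

namespace Summit.Ventures.CertifiedManyBodySolver.Observables

open Matrix Finset Literature.MathematicalPhysics.QuantumLattice Literature.Probability.LatticeModels
open Literature.MathematicalPhysics.QuantumLattice.HubbardWave0 ThermodynamicLimit Filter Topology
open Literature.MathematicalPhysics.QuantumManyBody.StateRelaxation
open scoped ComplexOrder BigOperators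

/-! ## §1  Torus dictionary for the box pair word -/

section Dictionary

variable {L : ℕ} [NeZero L]

/-- (Local to this section, as in the tree's pair-correlator files.) [folklore] -/
local instance (priority := high) instDecidableEqFermionTorusPairLRO : DecidableEq (FermionTorus 2 L) :=
  LinearOrder.toDecidableEq

omit [NeZero L] in
/-- `d4Site γ` is additive, hence respects differences. [folklore] -/
theorem d4Site_sub' (γ : DihedralGroup 4) (a b : TorusSite 2 L) :
    d4Site γ (b - a) = d4Site γ b - d4Site γ a :=
  (AddMonoidHom.mk' (d4Site γ) (d4Site_add γ)).map_sub b a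

/-- **`D₄` moves the pair two-point word at `(a, b)`**: `U_γ (Δ_a† Δ_b) U_γᴴ = Δ_{γa}† Δ_{γb}` for a form
factor of parity `χ` with `χ² = 1` (the two signs cancel). The `(a, b)` version of the tree's
`relabel_d4Perm_localPair_corr_of_parity` (`a = 0`). [cite: Scalapino1995, §2 eq. (2.3)] -/
theorem relabel_d4Perm_localPair_corr_of_parity' (γ : DihedralGroup 4) (g : Site 2 → ℝ) (χ : ℝ)
    (hχ : χ * χ = 1) (hg : ∀ e, g (d4Vec γ e) = χ * g e) (a b : TorusSite 2 L) :
    relabel (Orb.d4Perm γ) ((localPair g L a)ᴴ * localPair g L b) =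
      (localPair g L (d4Site γ a))ᴴ * localPair g L (d4Site γ b) := by
  rw [relabel_mul, relabel_conjTranspose, relabel_d4Perm_localPair_of_parity γ g χ hχ hg,
    relabel_d4Perm_localPair_of_parity γ g χ hχ hg, conjTranspose_smul, smul_mul_smul_comm,
    Complex.star_def, Complex.conj_ofReal, ← Complex.ofReal_mul, hχ, Complex.ofReal_one, one_smul]

/-- **Translation sum of the pair two-point word at `(a, b)`**: `Σ_w U_w (Δ_a† Δ_b) U_wᴴ = Σ_x Δ_x† Δ_{x+(b−a)}`.
The `(a, b)` version of the tree's `sum_conj_fockTranslate_localPair_corr`. [cite: Scalapino1995, §2 eq. (2.3)] -/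
theorem sum_conj_fockTranslate_localPair_corr' (g : Site 2 → ℝ) (a b : TorusSite 2 L) :
    ∑ w : TorusSite 2 L, (fockTranslate w).val * ((localPair g L a)ᴴ * localPair g L b) * (fockTranslate w).valᴴ =
      ∑ x : TorusSite 2 L, (localPair g L x)ᴴ * localPair g L (x + (b - a)) := by
  have hterm : ∀ w : TorusSite 2 L,
      (fockTranslate w).val * ((localPair g L a)ᴴ * localPair g L b) * (fockTranslate w).valᴴ =
        (localPair g L (a + w))ᴴ * localPair g L (b + w) := by
    intro w
    rw [← relabel_eq_fockRelabel_conj, relabel_mul, relabel_conjTranspose, relabel_translate_localPair,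
      relabel_translate_localPair]
  simp_rw [hterm]
  exact Fintype.sum_equiv (Equiv.addLeft a) _ _ fun w => by
    simp only [Equiv.coe_addLeft]
    rw [show b + w = a + w + (b - a) by abel]

/-- **Space-group sum of the pair two-point word at `(a, b)`**:
`Σ_{(w,γ) ∈ 𝕋_L × S} V (Δ_a† Δ_b) Vᴴ = Σ_{γ∈S} Σ_x Δ_x† Δ_{x + γ(b − a)}`. [cite: Han2020Bootstrap, §2 eq. (2)] -/
theorem sum_spaceGroupUnitary_conj_localPair_corr' (S : Finset (DihedralGroup 4)) (g : Site 2 → ℝ)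
    (χ : DihedralGroup 4 → ℝ) (hχ : ∀ γ ∈ S, χ γ * χ γ = 1)
    (hg : ∀ γ ∈ S, ∀ e, g (d4Vec γ e) = χ γ * g e) (a b : TorusSite 2 L) :
    ∑ gg : TorusSite 2 L × ↥S,
        spaceGroupUnitary S gg * ((localPair g L a)ᴴ * localPair g L b) * (spaceGroupUnitary S gg)ᴴ =
      ∑ γ ∈ S, ∑ x : TorusSite 2 L, (localPair g L x)ᴴ * localPair g L (x + d4Site γ (b - a)) := by
  rw [Fintype.sum_prod_type, Finset.sum_comm, ← Finset.sum_coe_sort S]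
  refine Finset.sum_congr rfl fun γ _ => ?_
  rw [d4Site_sub', ← sum_conj_fockTranslate_localPair_corr' g (d4Site (γ : DihedralGroup 4) a)
    (d4Site (γ : DihedralGroup 4) b)]
  refine Finset.sum_congr rfl fun w _ => ?_
  have hγ : relabel (Orb.d4Perm (γ : DihedralGroup 4)) ((localPair g L a)ᴴ * localPair g L b) =
      (localPair g L (d4Site (γ : DihedralGroup 4) a))ᴴ * localPair g L (d4Site (γ : DihedralGroup 4) b) :=
    relabel_d4Perm_localPair_corr_of_parity' _ g (χ γ) (hχ γ γ.2) (hg γ γ.2) a b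
  rw [relabel_eq_fockRelabel_conj, ← fockD4_apply] at hγ
  show (fockTranslate w).val * (fockD4 (L := L) (γ : DihedralGroup 4)).val * ((localPair g L a)ᴴ * localPair g L b) *
      ((fockTranslate w).val * (fockD4 (L := L) (γ : DihedralGroup 4)).val)ᴴ = _
  rw [← hγ, conjTranspose_mul]
  simp only [Matrix.mul_assoc]

/-- **Pull-back of the box pair word**: `Γ(ι_{Λ_B,L})(pairBoxWord S g B) = Σ_{x,y∈B} (Δ^L_x̄)† Δ^L_ȳ` with the
torus pairs `localPairOn S g L` (`x̄ = x mod L`). [cite: Scalapino1995, §2 eq. (2.4)] -/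
theorem fermionEmbed_toTorusEmb_pairBoxWord (S : Finset (Site 2)) (g : Site 2 → ℝ) (B : Finset (Site 2))
    (hInj : Set.InjOn (Torus.proj (d := 2) L) ↑(B.biUnion (pairRegion S))) :
    fermionEmbed (PolySite.toTorusEmb L hInj) (pairBoxWord S g B) =
      ∑ x ∈ B, ∑ y ∈ B, (localPairOn S g L (Torus.proj L x))ᴴ * localPairOn S g L (Torus.proj L y) := by
  unfold pairBoxWord
  rw [fermionEmbed_sum, ← Finset.sum_attach B (fun x => ∑ y ∈ B,
    (localPairOn S g L (Torus.proj L x))ᴴ * localPairOn S g L (Torus.proj L y))]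
  refine Finset.sum_congr rfl fun x _ => ?_
  rw [fermionEmbed_sum, ← Finset.sum_attach B (fun y =>
    (localPairOn S g L (Torus.proj L (x : Site 2)))ᴴ * localPairOn S g L (Torus.proj L y))]
  refine Finset.sum_congr rfl fun y _ => ?_
  rw [fermionEmbed_mul, fermionEmbed_toTorusEmb_incl, fermionEmbed_toTorusEmb_incl, fermionEmbed_conjTranspose,
    fermionEmbed_toTorusEmb_localPairAt, fermionEmbed_toTorusEmb_localPairAt]

/-- **The orbit-state value of the `d`-wave box pair word on the torus**:
`Re ω̄_ψ(Γ(ι) pairBoxWord B) = (Σ_{γ∈S} Σ_{x,y∈B} Re⟨ψ, (Σ_z Δ_z† Δ_{z+γ(ȳ−x̄)}) ψ⟩) / (L² |S|)`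
(`ω̄_ψ = orbitState (spaceGroupUnitary S) ψ`, `S ∋ 1`). [cite: Han2020Bootstrap, §2 eq. (2)] -/
theorem re_orbitState_pairBoxWord_eq {S : Finset (DihedralGroup 4)} (h1 : (1 : DihedralGroup 4) ∈ S)
    (B : Finset (Site 2))
    (hInj : Set.InjOn (Torus.proj (d := 2) L) ↑(B.biUnion (pairRegion (insert (0 : Site 2) unitSteps))))
    (ψ : Fock (Orb (FermionTorus 2 L))) :
    (orbitState (spaceGroupUnitary S) ψ
        (fermionEmbed (PolySite.toTorusEmb L hInj) (pairBoxWord (insert (0 : Site 2) unitSteps) dWaveFormFactor B))).re =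
      (∑ γ ∈ S, ∑ x ∈ B, ∑ y ∈ B, (star ψ ⬝ᵥ ((∑ z : TorusSite 2 L, (localPair dWaveFormFactor L z)ᴴ *
        localPair dWaveFormFactor L (z + d4Site γ (Torus.proj L y - Torus.proj L x))) *ᵥ ψ)).re) /
        ((L : ℝ) ^ 2 * S.card) := by
  have hLr : ((L : ℝ)) ^ 2 * S.card ≠ 0 :=
    mul_ne_zero (pow_ne_zero 2 (Nat.cast_ne_zero.2 (NeZero.ne L)))
      (Nat.cast_ne_zero.2 (Finset.card_ne_zero.2 ⟨1, h1⟩))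
  -- the space-group sum of the pulled-back box word
  have hsum : ∑ gg : TorusSite 2 L × ↥S, spaceGroupUnitary S gg *
      fermionEmbed (PolySite.toTorusEmb L hInj) (pairBoxWord (insert (0 : Site 2) unitSteps) dWaveFormFactor B) *
        (spaceGroupUnitary S gg)ᴴ =
      ∑ x ∈ B, ∑ y ∈ B, ∑ γ ∈ S, ∑ z : TorusSite 2 L, (localPair dWaveFormFactor L z)ᴴ *
        localPair dWaveFormFactor L (z + d4Site γ (Torus.proj L y - Torus.proj L x)) := by
    rw [fermionEmbed_toTorusEmb_pairBoxWord]
    simp_rw [localPairOn_insert_zero_unitSteps, Finset.mul_sum, Finset.sum_mul]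
    rw [Finset.sum_comm]
    refine Finset.sum_congr rfl fun x _ => ?_
    rw [Finset.sum_comm]
    refine Finset.sum_congr rfl fun y _ => ?_
    exact sum_spaceGroupUnitary_conj_localPair_corr' S dWaveFormFactor b1gSign (fun γ _ => b1gSign_mul_self γ)
      (fun γ _ e => dWaveFormFactor_d4Vec_eq_b1gSign_mul γ e) _ _
  have h := star_dotProduct_sum_spaceGroup_conj_mulVec h1 ψ
    (fermionEmbed (PolySite.toTorusEmb L hInj) (pairBoxWord (insert (0 : Site 2) unitSteps) dWaveFormFactor B))
  rw [hsum] at h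
  simp only [Matrix.sum_mulVec, dotProduct_sum] at h
  -- reorder the scalar sums to `Σ_γ Σ_x Σ_y`
  have hre : (∑ γ ∈ S, ∑ x ∈ B, ∑ y ∈ B, (star ψ ⬝ᵥ ((∑ z : TorusSite 2 L, (localPair dWaveFormFactor L z)ᴴ *
        localPair dWaveFormFactor L (z + d4Site γ (Torus.proj L y - Torus.proj L x))) *ᵥ ψ)).re) =
      (∑ x ∈ B, ∑ y ∈ B, ∑ γ ∈ S, ∑ z : TorusSite 2 L, star ψ ⬝ᵥ (((localPair dWaveFormFactor L z)ᴴ *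
        localPair dWaveFormFactor L (z + d4Site γ (Torus.proj L y - Torus.proj L x))) *ᵥ ψ)).re := by
    rw [Complex.re_sum, Finset.sum_comm]
    refine Finset.sum_congr rfl fun x _ => ?_
    rw [Complex.re_sum, Finset.sum_comm]
    refine Finset.sum_congr rfl fun y _ => ?_
    rw [Complex.re_sum]
    refine Finset.sum_congr rfl fun γ _ => ?_
    rw [Matrix.sum_mulVec, dotProduct_sum, Complex.re_sum]
  rw [hre, h]
  have hc : ((L ^ 2 * S.card : ℕ) : ℂ) = ((((L : ℝ)) ^ 2 * S.card : ℝ) : ℂ) := by push_cast; ring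
  rw [hc, Complex.re_ofReal_mul, mul_div_cancel_left₀ _ hLr]

end Dictionary

/-! ## §2  Kinematics: the orbit-averaged box functional dominates the pair-field density -/

section Kinematic

variable {L : ℕ} [NeZero L]

/-- (Local to this section.) [folklore] -/
local instance (priority := high) instDecidableEqFermionTorusPairLRO' : DecidableEq (FermionTorus 2 L) :=
  LinearOrder.toDecidableEq

/-- **Box average on a rotated box**: for every `γ ∈ D₄`, every window `B ⊆ ℤ²` on which `x ↦ x mod L` is
injective and every torus vector `ψ`,
`|B|² · Re⟨ψ, Δ_g† Δ_g ψ⟩ ≤ L² · Σ_{x,y∈B} Re⟨ψ, (Σ_z Δ_z† Δ_{z+γ(ȳ−x̄)}) ψ⟩` — the torus Fejér bound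
`pairField_card_sq_mul_re_expect_le` for the window `γB̄`. [cite: Scalapino1995, §2] -/
theorem sq_card_mul_re_expect_pairField_le_sum_d4 (g : Site 2 → ℝ) (γ : DihedralGroup 4) (B : Finset (Site 2))
    (hInjB : Set.InjOn (Torus.proj (d := 2) L) ↑B) (ψ : Fock (Orb (FermionTorus 2 L))) :
    ((B.card : ℝ)) ^ 2 * (expect ((pairField g L)ᴴ * pairField g L) ψ).re ≤
      (L : ℝ) ^ 2 * ∑ x ∈ B, ∑ y ∈ B, (star ψ ⬝ᵥ ((∑ z : TorusSite 2 L, (localPair g L z)ᴴ *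
        localPair g L (z + d4Site γ (Torus.proj L y - Torus.proj L x))) *ᵥ ψ)).re := by
  set f : Site 2 → TorusSite 2 L := fun x => d4Site γ (Torus.proj L x) with hf
  have hfinj : Set.InjOn f ↑B := by
    intro a ha b hb h
    exact hInjB ha hb (d4Site_injective (L := L) γ h)
  have hcard : (B.image f).card = B.card := Finset.card_image_of_injOn hfinj
  have h := pairField_card_sq_mul_re_expect_le g L (B.image f) ψ
  rw [hcard, Finset.sum_image hfinj] at h
  refine h.trans (le_of_eq ?_)
  congr 1
  refine Finset.sum_congr rfl fun x _ => ?_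
  rw [Finset.sum_image hfinj]
  refine Finset.sum_congr rfl fun y _ => ?_
  rw [Matrix.sum_mulVec, dotProduct_sum, Complex.re_sum]
  refine Finset.sum_congr rfl fun z _ => ?_
  rw [hf]
  dsimp only
  rw [← d4Site_sub']
  rfl

/-- **KINEMATIC DOMINATION (every torus vector).** For `S ∋ 1`, every window `B` fitting the torus
(`x ↦ x mod L` injective on `⋃_{x∈B} pairRegion S_d x`) and every `ψ`:
`|B|² · L⁻⁴ · Re⟨ψ, Δ_d† Δ_d ψ⟩ ≤ Re ω̄_ψ(Γ(ι_{Λ_B,L}) pairBoxWord B)`, `ω̄_ψ = orbitState (spaceGroupUnitary S) ψ`.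
[cite: Yang1962, §3] -/
theorem sq_card_mul_pairFieldDensity_le_re_orbitState_pairBoxWord {S : Finset (DihedralGroup 4)}
    (h1 : (1 : DihedralGroup 4) ∈ S) (B : Finset (Site 2))
    (hInj : Set.InjOn (Torus.proj (d := 2) L) ↑(B.biUnion (pairRegion (insert (0 : Site 2) unitSteps))))
    (ψ : Fock (Orb (FermionTorus 2 L))) :
    ((B.card : ℝ)) ^ 2 * ((expect ((pairField dWaveFormFactor L)ᴴ * pairField dWaveFormFactor L) ψ).re / (L : ℝ) ^ 4) ≤
      (orbitState (spaceGroupUnitary S) ψ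
        (fermionEmbed (PolySite.toTorusEmb L hInj) (pairBoxWord (insert (0 : Site 2) unitSteps) dWaveFormFactor B))).re := by
  have hL : (0 : ℝ) < (L : ℝ) := by exact_mod_cast Nat.pos_of_ne_zero (NeZero.ne L)
  have hS : (0 : ℝ) < (S.card : ℝ) := by exact_mod_cast Finset.card_pos.2 ⟨1, h1⟩
  have hInjB : Set.InjOn (Torus.proj (d := 2) L) ↑B :=
    hInj.mono fun x hx => Finset.mem_biUnion.2 ⟨x, hx, self_mem_pairRegion _ x⟩
  rw [re_orbitState_pairBoxWord_eq h1 B hInj ψ, le_div_iff₀ (by positivity)]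
  -- sum the rotated-box bounds over `γ ∈ S`
  have hsum := Finset.sum_le_sum fun γ (_ : γ ∈ S) =>
    sq_card_mul_re_expect_pairField_le_sum_d4 dWaveFormFactor γ B hInjB ψ
  rw [Finset.sum_const, nsmul_eq_mul, ← Finset.mul_sum] at hsum
  have hL2 : (0 : ℝ) < (L : ℝ) ^ 2 := by positivity
  have hrew : ((B.card : ℝ)) ^ 2 * ((expect ((pairField dWaveFormFactor L)ᴴ * pairField dWaveFormFactor L) ψ).re /
      (L : ℝ) ^ 4) * ((L : ℝ) ^ 2 * S.card) =
      ((S.card : ℝ) * (((B.card : ℝ)) ^ 2 *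
        (expect ((pairField dWaveFormFactor L)ᴴ * pairField dWaveFormFactor L) ψ).re)) / (L : ℝ) ^ 2 := by
    field_simp
  rw [hrew, div_le_iff₀ hL2]
  linarith [hsum]

end Kinematic

end Summit.Ventures.CertifiedManyBodySolver.Observables

end
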